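import Summits.RiemannHypothesis.RiemannHypothesis.Theorems.SignConeConeMagnificationCombTypeAssemblyPairData
import Literature.NumberTheory.LFunctions.LogRieszWeights
import Literature.NumberTheory.LFunctions.DesignDataOfTypes

/-!
# Crux `SignCone.SlackDesign` (stmt-RiemannHypothesis-18009), line `real_comb_type`, stub `stub_combDiffAsymp` — glue:
# the comb-difference asymptotic from PAIR-LEVEL sharp node data

The registered stub `stub_combDiffAsymp` (Cruxes/SlackDesign/Lines/real_comb_type.lean) says: for `c ≥ 0` with Chebyshev, Mertens
and local summability, a real design `α` on `[1, L]` and a bump `b`,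

  `Σ_{ℓ,ℓ'} α_ℓ α_ℓ' (E_c − E_Λ)(ℓ,ℓ') / log M − (∫ b²)·Σ_{n<M} ((c−Λ)(n)/n)·Re Φ_α(n)·(1 − log n/log M)₊ → 0`  (`M → ∞`).

This file proves it from the PAIR-LEVEL DATA of the parent crux's interface `CombType.combType_of_pairData`
(Theorems/SignConeConeMagnificationCombTypeOfPairData.lean, p154004): eventually in `M`, for every pair `ℓ, ℓ' ≤ L` there is a class
term `S` with `|S| ≤ C(log M)^θ` and

  `|(E_c − E_Λ)(ℓ,ℓ') − Σ_{n ≤ 3LM} (c−Λ)(n)·(B₀√(ℓ/ℓ')·(Σ_{k' ≤ ⌊X_M/(nℓ')⌋}[ℓ ∣ nℓ'k']/k')/n + S(gcd(nℓ',ℓ))/n)| ≤ C(log M)^θ`,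

`X_M = M/(4√(log M))`, some `θ < 1`.  MECHANISM (no quantitative comparison of the two cut-off families is needed): by the landed
per-pair evaluation `CombType.pair_bound_of_pairData` the normalised difference is `B₀·Σ_{ℓ,ℓ',δ} coef·Σ_n z_n 1[gcd = δ]·w^{harm}_M(n)`
up to `O((log M)^{θ-1})`, with the HARMONIC cut-off weights `w^{harm}_M(n) = H(⌊X_M/(nℓ')⌋/(ℓ/δ))/log M` of `…CombTypeWeights`; the
subtracted log-Riesz mean is `B₀·Σ_{ℓ,ℓ',δ} coef·Σ_n z_n 1[gcd = δ]·w^{LR}_M(n)`, `w^{LR}_M(n) = (1 − log n/log M)₊`; BOTH weight families are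
regular cut-off families (antitone, in `[0,1]`-ish, eventually zero, `→ 1` pointwise), so by the referee's Abel lemma
`TypeDesign.tendsto_sum_mul_weight_of_tendsto` both weighted class sums converge to the SAME class limit
(`TypeDesign.gcdClassSum_converges`, from `c ≥ 0`, local summability and the Mertens difference), and the difference tends to `0`.

* `combDiffAsymp_of_pairData` — the statement, for an ABSTRACT node-weight function `V` and constant `B₀` (only the pair data are used).
-/

noncomputable section

-- `Summit.RiemannHypothesis.RiemannHypothesis.…` repeats a namespace component by design (D-0017 layout).
set_option linter.dupNamespace false

open scoped BigOperators ComplexConjugate Topology ArithmeticFunction.vonMangoldt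
open Complex MeasureTheory Set Filter

namespace Summit.RiemannHypothesis.RiemannHypothesis.Theorems.SignConeSlackDesign

open Literature.NumberTheory.LFunctions
open Literature.NumberTheory.LFunctions.GcdForm (gcdForm)
open Summit.RiemannHypothesis.RiemannHypothesis.Theorems.SignConeConeMagnification

/-- Regularity of the uniform log-Riesz weights `(1 − log n/log M)₊` (`TypeDesign.logRiesz_regular` at `κ = r = 1`). [folklore] -/
theorem logRiesz_one_regular' :
    (∀ᶠ M : ℕ in atTop, Antitone (fun n : ℕ => max (1 - Real.log n / Real.log M) 0)) ∧
    (∀ᶠ M : ℕ in atTop, ∀ n : ℕ, 0 ≤ max (1 - Real.log n / Real.log M) 0) ∧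
    (∀ᶠ M : ℕ in atTop, ∀ n : ℕ, max (1 - Real.log n / Real.log M) 0 ≤ 1) ∧
    (∀ᶠ M : ℕ in atTop, ∀ n : ℕ, M ≤ n → max (1 - Real.log n / Real.log M) 0 = 0) ∧
    (∀ n : ℕ, Tendsto (fun M : ℕ => max (1 - Real.log n / Real.log M) 0) atTop (𝓝 1)) := by
  have h := TypeDesign.logRiesz_regular (κ := fun _ : ℕ => (1 : ℝ)) (r := 1)
    (Eventually.of_forall fun M => by norm_num) (by simp)
  simpa only [one_mul] using h

/-- `(log M)^θ / log M → 0` along `ℕ` for `θ < 1`, with a constant factor. [folklore] -/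
theorem tendsto_const_mul_log_rpow_div_log {θ : ℝ} (hθ : θ < 1) (C : ℝ) :
    Tendsto (fun M : ℕ => C * Real.log M ^ θ / Real.log M) atTop (𝓝 0) := by
  have h1 : Tendsto (fun M : ℕ => Real.log M ^ (θ - 1)) atTop (𝓝 0) := by
    have := (tendsto_rpow_neg_atTop (by linarith : 0 < 1 - θ)).comp
      (Real.tendsto_log_atTop.comp tendsto_natCast_atTop_atTop)
    refine this.congr fun M => ?_
    simp only [Function.comp_apply]
    rw [show -(1 - θ) = θ - 1 by ring]
  have h2 := h1.const_mul C
  rw [mul_zero] at h2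
  refine h2.congr' ?_
  filter_upwards [eventually_ge_atTop 2] with M hM
  have hlog : 0 < Real.log M := Real.log_pos (by exact_mod_cast (by omega : 1 < M))
  rw [Real.rpow_sub hlog, Real.rpow_one]
  field_simp

/-- **The comb-difference asymptotic from pair-level data.**  See the module docstring.  `V` is an arbitrary node-weight
function and `B₀` an arbitrary constant: only the pair data `hpd` (the middle conjunct of the parent interface
`CombType.combType_of_pairData`, with the class term bound) are used, together with `c ≥ 0`, Mertens and local summability
(for the convergence of the gcd-class sums). [folklore] -/
theorem combDiffAsymp_of_pairData (c : ℕ → ℝ) (hc0 : ∀ n, 0 ≤ c n)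
    (hMer : ∃ C : ℝ, Tendsto (fun x : ℝ => (∑ n ∈ Finset.Icc 1 ⌊x⌋₊, c n / n) - Real.log x) atTop (𝓝 C))
    (hLoc : ∀ p : ℕ, p.Prime → Summable (fun n : ℕ => if p ∣ n then c n / n else 0))
    (α : ℕ → ℝ) {L : ℕ} (hL : 1 ≤ L) (B₀ : ℝ) (V : ℕ → ℕ → ℕ → ℕ → ℝ)
    {Cst θ : ℝ} (hθ : θ < 1)
    (hpd : ∀ᶠ M : ℕ in atTop, ∀ ℓ ∈ Finset.Icc 1 L, ∀ ℓ' ∈ Finset.Icc 1 L,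
      ∃ S : ℕ → ℝ,
        (∀ δ, |S δ| ≤ Cst * Real.log M ^ θ) ∧
        (|((∑ n ∈ Finset.Icc 1 (3 * L * M), c n * V M ℓ ℓ' n) - ∑ n ∈ Finset.Icc 1 (3 * L * M), (Λ n : ℝ) * V M ℓ ℓ' n) -
          ∑ n ∈ Finset.Icc 1 (3 * L * M), (c n - Λ n) *
            (B₀ * (Real.sqrt ℓ / Real.sqrt ℓ') *
                (∑ k' ∈ Finset.Icc 1 (⌊(M : ℝ) / (4 * Real.sqrt (Real.log M)) / ((n : ℝ) * ℓ')⌋₊),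
                  (if ℓ ∣ n * ℓ' * k' then (1 : ℝ) / k' else 0)) / n +
              S (Nat.gcd (n * ℓ') ℓ) / n)| ≤ Cst * Real.log M ^ θ)) :
    Tendsto (fun M : ℕ =>
      ((∑ ℓ ∈ Finset.Icc 1 L, ∑ ℓ' ∈ Finset.Icc 1 L, α ℓ * α ℓ' *
          ∑ n ∈ Finset.Icc 1 (3 * L * M), c n * V M ℓ ℓ' n) -
        (∑ ℓ ∈ Finset.Icc 1 L, ∑ ℓ' ∈ Finset.Icc 1 L, α ℓ * α ℓ' *
          ∑ n ∈ Finset.Icc 1 (3 * L * M), (Λ n : ℝ) * V M ℓ ℓ' n)) / Real.log M -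
      B₀ * ∑ n ∈ Finset.range M, (c n - Λ n) / n *
        (gcdForm (fun m => ((α m : ℝ) : ℂ)) L n).re * max (1 - Real.log n / Real.log M) 0)
      atTop (𝓝 0) := by
  classical
  -- notation
  set d : ℕ → ℝ := fun n => (c n - Λ n) / n with hd
  set coef : ℕ → ℕ → ℕ → ℝ := fun ℓ ℓ' δ => α ℓ * α ℓ' * δ / Real.sqrt ((ℓ : ℝ) * ℓ') with hcoef
  set ind : ℕ → ℕ → ℕ → ℕ → ℝ := fun ℓ ℓ' δ n => if Nat.gcd (n * ℓ') ℓ = δ then (1 : ℝ) else 0 with hind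
  set X : ℕ → ℝ := fun M => (M : ℝ) / (4 * Real.sqrt (Real.log M)) with hX
  set w : ℕ → ℕ → ℕ → ℕ → ℕ → ℝ := fun ℓ ℓ' δ M n =>
    (∑ j ∈ Finset.Icc 1 (⌊X M / ((max n 1 : ℕ) * ℓ')⌋₊ / (ℓ / δ)), (1 : ℝ) / j) / Real.log M with hw
  set wL : ℕ → ℕ → ℝ := fun M n => max (1 - Real.log n / Real.log M) 0 with hwL
  set Dp : ℕ → ℕ → ℕ → ℝ := fun M ℓ ℓ' =>
    (∑ n ∈ Finset.Icc 1 (3 * L * M), c n * V M ℓ ℓ' n) - ∑ n ∈ Finset.Icc 1 (3 * L * M), (Λ n : ℝ) * V M ℓ ℓ' n with hDp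
  set Qh : ℕ → ℝ := fun M => ∑ ℓ ∈ Finset.Icc 1 L, ∑ ℓ' ∈ Finset.Icc 1 L, ∑ δ ∈ ℓ.divisors,
      coef ℓ ℓ' δ * ∑ n ∈ Finset.range (3 * L * M + 1), d n * ind ℓ ℓ' δ n * w ℓ ℓ' δ M n with hQh
  set QL : ℕ → ℝ := fun M => ∑ ℓ ∈ Finset.Icc 1 L, ∑ ℓ' ∈ Finset.Icc 1 L, ∑ δ ∈ ℓ.divisors,
      coef ℓ ℓ' δ * ∑ n ∈ Finset.range M, d n * ind ℓ ℓ' δ n * wL M n with hQL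
  -- the Mertens difference along `ℕ`
  obtain ⟨C, hC⟩ := hMer
  have hC₁ : Tendsto (fun N : ℕ => ∑ n ∈ Finset.range N, (c n - Λ n) / n) atTop
      (𝓝 (C + Real.eulerMascheroniConstant)) :=
    TypeDesign.tendsto_sum_range_of_tendsto_sum_Icc_floor (f := fun n => (c n - Λ n) / n) (by simp)
      (TypeDesign.tendsto_sum_sub_vonMangoldt_div_of_mertens hC)
  -- class limits
  have hcls : ∀ ℓ ℓ' δ : ℕ, ∃ Tc : ℝ, ℓ ∈ Finset.Icc 1 L →
      Tendsto (fun N : ℕ => ∑ n ∈ Finset.range N, d n * ind ℓ ℓ' δ n) atTop (𝓝 Tc) := by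
    intro ℓ ℓ' δ
    by_cases hℓ : ℓ ∈ Finset.Icc 1 L
    · obtain ⟨Tc, hTc⟩ := TypeDesign.gcdClassSum_converges hc0 hLoc hC₁ hℓ ℓ' δ
      exact ⟨Tc, fun _ => by simpa only [hd, hind] using hTc⟩
    · exact ⟨0, fun h => (hℓ h).elim⟩
  choose Tc hTc using hcls
  set Tinf : ℝ := ∑ ℓ ∈ Finset.Icc 1 L, ∑ ℓ' ∈ Finset.Icc 1 L, ∑ δ ∈ ℓ.divisors, coef ℓ ℓ' δ * Tc ℓ ℓ' δ with hTinf
  -- class partial sums are bounded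
  have hbdd : ∀ ℓ ℓ' δ : ℕ, ∃ K : ℝ, 0 ≤ K ∧ (ℓ ∈ Finset.Icc 1 L → ∀ N, |∑ n ∈ Finset.range N, d n * ind ℓ ℓ' δ n| ≤ K) := by
    intro ℓ ℓ' δ
    by_cases hℓ : ℓ ∈ Finset.Icc 1 L
    · obtain ⟨C, hC⟩ := isBounded_iff_forall_norm_le.1 (Metric.isBounded_range_of_tendsto _ (hTc ℓ ℓ' δ hℓ))
      refine ⟨max C 0, le_max_right _ _, fun _ N => ?_⟩
      have := hC _ ⟨N, rfl⟩
      rw [Real.norm_eq_abs] at this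
      exact this.trans (le_max_left _ _)
    · exact ⟨0, le_rfl, fun h => (hℓ h).elim⟩
  choose K hK0 hK using hbdd
  -- (i) the harmonic-weighted class sums tend to `Tinf`
  have hQh_lim : Tendsto Qh atTop (𝓝 Tinf) := by
    simp only [hQh, hTinf]
    refine tendsto_finsetSum _ fun ℓ hℓ => tendsto_finsetSum _ fun ℓ' hℓ' => tendsto_finsetSum _ fun δ hδ => ?_
    refine ((TypeDesign.tendsto_sum_mul_weight_of_tendsto (hTc ℓ ℓ' δ hℓ) (w ℓ ℓ' δ) (fun M => 3 * L * M + 1)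
      ?_ ?_ ?_ ?_).const_mul _)
    · -- antitone
      filter_upwards [eventually_ge_atTop 1] with M hM
      have hXM : 0 ≤ X M := by simp only [hX]; positivity
      have hlog : 0 ≤ Real.log M := Real.log_natCast_nonneg M
      intro n m hnm
      simp only [hw]
      exact div_le_div_of_nonneg_right (CombType.harmWeight_antitone hXM (ℓ / δ) (Finset.mem_Icc.1 hℓ').1 hnm) hlog
    · -- nonneg
      filter_upwards [eventually_ge_atTop 1] with M hM n
      simp only [hw]
      exact div_nonneg (CombType.harmWeight_nonneg _ _ _ _) (Real.log_natCast_nonneg M)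
    · -- zero beyond `3LM+1`
      filter_upwards [eventually_ge_atTop 2] with M hM n hn
      simp only [hw]
      have hℓ'1 := (Finset.mem_Icc.1 hℓ').1
      have hn1 : 1 ≤ n := le_trans (by omega) hn
      have hXlt : X M < n * ℓ' := by
        have hM2 : (2 : ℝ) ≤ M := by exact_mod_cast hM
        have hl2 : (1 / 2 : ℝ) < Real.log 2 := by linarith [Real.log_two_gt_d9]
        have hsq : 1 / 2 < Real.sqrt (Real.log M) := by
          have : Real.sqrt (1 / 4) = 1 / 2 := by
            rw [show (1 / 4 : ℝ) = (1 / 2) ^ 2 by norm_num, Real.sqrt_sq (by norm_num)]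
          rw [← this]
          exact Real.sqrt_lt_sqrt (by norm_num) (by linarith [Real.log_le_log two_pos hM2])
        have h1 : X M < M := by
          simp only [hX]
          rw [div_lt_iff₀ (by positivity)]
          nlinarith
        have h2 : (M : ℝ) ≤ n := by
          have : M ≤ n := le_trans (by nlinarith [hL]) hn
          exact_mod_cast this
        have h3 : (n : ℝ) ≤ n * ℓ' := by
          have : (1 : ℝ) ≤ ℓ' := by exact_mod_cast hℓ'1
          have hn0 : (0 : ℝ) ≤ n := Nat.cast_nonneg n
          nlinarith
        linarith
      rw [CombType.harmWeight_eq_zero (ℓ / δ) ℓ' hn1 hXlt, zero_div]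
    · -- tends to one
      intro n
      have hq : 1 ≤ ℓ / δ := Nat.div_pos (Nat.le_of_dvd (Finset.mem_Icc.1 hℓ).1 (Nat.dvd_of_mem_divisors hδ))
        (Nat.pos_of_mem_divisors hδ)
      simpa only [hw, hX] using CombType.tendsto_harmWeight_div_log hq (Finset.mem_Icc.1 hℓ').1 n
  -- (ii) the log-Riesz-weighted class sums tend to `Tinf` as well
  have hQL_lim : Tendsto QL atTop (𝓝 Tinf) := by
    simp only [hQL, hTinf]
    obtain ⟨hw_anti, hw_nonneg, -, hw_zero, hw_one⟩ := logRiesz_one_regular'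
    refine tendsto_finsetSum _ fun ℓ hℓ => tendsto_finsetSum _ fun ℓ' _ => tendsto_finsetSum _ fun δ _ => ?_
    exact ((TypeDesign.tendsto_sum_mul_weight_of_tendsto (hTc ℓ ℓ' δ hℓ) wL (fun M => M)
      hw_anti hw_nonneg hw_zero hw_one).const_mul _)
  -- the subtracted log-Riesz mean IS `B₀ · QL`
  have hLR : ∀ M : ℕ, B₀ * ∑ n ∈ Finset.range M, (c n - Λ n) / n *
        (gcdForm (fun m => ((α m : ℝ) : ℂ)) L n).re * max (1 - Real.log n / Real.log M) 0 = B₀ * QL M := by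
    intro M
    congr 1
    have h1 : ∑ n ∈ Finset.range M, (c n - Λ n) / n * (gcdForm (fun m => ((α m : ℝ) : ℂ)) L n).re *
          max (1 - Real.log n / Real.log M) 0 =
        ∑ n ∈ Finset.range M, (d n * wL M n) * (gcdForm (fun m => ((α m : ℝ) : ℂ)) L n).re := by
      refine Finset.sum_congr rfl fun n _ => ?_
      simp only [hd, hwL]
      ring
    rw [h1, TypeDesign.sum_mul_re_gcdForm_eq_sum_gcdClasses]
    simp only [hQL]
    refine Finset.sum_congr rfl fun ℓ _ => Finset.sum_congr rfl fun ℓ' _ => Finset.sum_congr rfl fun δ _ => ?_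
    rw [CombType.re_coef_ofReal, Finset.mul_sum, Finset.mul_sum]
    refine Finset.sum_congr rfl fun n _ => ?_
    simp only [hcoef, hind]
    ring
  -- (iii) the pair data: eventually `|Σ αα' Dp − B₀ log M · Qh| ≤ Ctot (log M)^θ`
  set Ctot : ℝ := ∑ ℓ ∈ Finset.Icc 1 L, ∑ ℓ' ∈ Finset.Icc 1 L, |α ℓ * α ℓ'| *
      (Cst * (∑ δ ∈ ℓ.divisors, K ℓ ℓ' δ) + Cst + Cst) with hCtot
  have herr : ∀ᶠ M : ℕ in atTop,
      |(∑ ℓ ∈ Finset.Icc 1 L, ∑ ℓ' ∈ Finset.Icc 1 L, α ℓ * α ℓ' * Dp M ℓ ℓ') - B₀ * Real.log M * Qh M| ≤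
        Ctot * Real.log M ^ θ := by
    filter_upwards [hpd, eventually_ge_atTop 2] with M hpdM hM2
    have hlog : 0 < Real.log M := Real.log_pos (by exact_mod_cast (by omega : 1 < M))
    -- per pair
    have hpair : ∀ ℓ ∈ Finset.Icc 1 L, ∀ ℓ' ∈ Finset.Icc 1 L,
        |Dp M ℓ ℓ' - B₀ * Real.log M * (∑ δ ∈ ℓ.divisors, (δ : ℝ) / Real.sqrt ((ℓ : ℝ) * ℓ') *
            ∑ n ∈ Finset.range (3 * L * M + 1), d n * ind ℓ ℓ' δ n * w ℓ ℓ' δ M n)| ≤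
          (Cst * (∑ δ ∈ ℓ.divisors, K ℓ ℓ' δ) + Cst + Cst) * Real.log M ^ θ := by
      intro ℓ hℓ ℓ' hℓ'
      obtain ⟨S, hS, hpdS⟩ := hpdM ℓ hℓ ℓ' hℓ'
      have := CombType.pair_bound_of_pairData hℓ hℓ' hlog V S hS hpdS (K ℓ ℓ') (fun δ N => hK ℓ ℓ' δ hℓ N)
      simpa only [hDp, hd, hind, hw, hX] using this
    -- sum over pairs
    have hexp : (∑ ℓ ∈ Finset.Icc 1 L, ∑ ℓ' ∈ Finset.Icc 1 L, α ℓ * α ℓ' * Dp M ℓ ℓ') - B₀ * Real.log M * Qh M =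
        ∑ ℓ ∈ Finset.Icc 1 L, ∑ ℓ' ∈ Finset.Icc 1 L, α ℓ * α ℓ' *
          (Dp M ℓ ℓ' - B₀ * Real.log M * (∑ δ ∈ ℓ.divisors, (δ : ℝ) / Real.sqrt ((ℓ : ℝ) * ℓ') *
            ∑ n ∈ Finset.range (3 * L * M + 1), d n * ind ℓ ℓ' δ n * w ℓ ℓ' δ M n)) := by
      simp only [hQh, Finset.mul_sum, mul_sub, Finset.sum_sub_distrib]
      congr 1
      refine Finset.sum_congr rfl fun ℓ _ => Finset.sum_congr rfl fun ℓ' _ => Finset.sum_congr rfl fun δ _ => ?_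
      simp only [hcoef]
      ring
    rw [hexp]
    simp only [hCtot]
    rw [Finset.sum_mul]
    refine (Finset.abs_sum_le_sum_abs _ _).trans (Finset.sum_le_sum fun ℓ hℓ => ?_)
    rw [Finset.sum_mul]
    refine (Finset.abs_sum_le_sum_abs _ _).trans (Finset.sum_le_sum fun ℓ' hℓ' => ?_)
    have h := mul_le_mul_of_nonneg_left (hpair ℓ hℓ ℓ' hℓ') (abs_nonneg (α ℓ * α ℓ'))
    rw [abs_mul]
    nlinarith [h]
  -- assemble: `seq M = (Σ αα' Dp − B₀ log M Qh)/log M + B₀ (Qh M − QL M)`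
  have hsplit : ∀ᶠ M : ℕ in atTop,
      ((∑ ℓ ∈ Finset.Icc 1 L, ∑ ℓ' ∈ Finset.Icc 1 L, α ℓ * α ℓ' *
          ∑ n ∈ Finset.Icc 1 (3 * L * M), c n * V M ℓ ℓ' n) -
        (∑ ℓ ∈ Finset.Icc 1 L, ∑ ℓ' ∈ Finset.Icc 1 L, α ℓ * α ℓ' *
          ∑ n ∈ Finset.Icc 1 (3 * L * M), (Λ n : ℝ) * V M ℓ ℓ' n)) / Real.log M -
      B₀ * ∑ n ∈ Finset.range M, (c n - Λ n) / n *
        (gcdForm (fun m => ((α m : ℝ) : ℂ)) L n).re * max (1 - Real.log n / Real.log M) 0 =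
      ((∑ ℓ ∈ Finset.Icc 1 L, ∑ ℓ' ∈ Finset.Icc 1 L, α ℓ * α ℓ' * Dp M ℓ ℓ') - B₀ * Real.log M * Qh M) / Real.log M +
        B₀ * (Qh M - QL M) := by
    filter_upwards [eventually_ge_atTop 2] with M hM2
    have hlog : 0 < Real.log M := Real.log_pos (by exact_mod_cast (by omega : 1 < M))
    rw [hLR M]
    have hD : (∑ ℓ ∈ Finset.Icc 1 L, ∑ ℓ' ∈ Finset.Icc 1 L, α ℓ * α ℓ' *
          ∑ n ∈ Finset.Icc 1 (3 * L * M), c n * V M ℓ ℓ' n) -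
        (∑ ℓ ∈ Finset.Icc 1 L, ∑ ℓ' ∈ Finset.Icc 1 L, α ℓ * α ℓ' *
          ∑ n ∈ Finset.Icc 1 (3 * L * M), (Λ n : ℝ) * V M ℓ ℓ' n) =
        ∑ ℓ ∈ Finset.Icc 1 L, ∑ ℓ' ∈ Finset.Icc 1 L, α ℓ * α ℓ' * Dp M ℓ ℓ' := by
      simp only [hDp, mul_sub, Finset.sum_sub_distrib]
    rw [hD]
    field_simp
    ring
  -- the two limits
  have hA : Tendsto (fun M : ℕ =>
      ((∑ ℓ ∈ Finset.Icc 1 L, ∑ ℓ' ∈ Finset.Icc 1 L, α ℓ * α ℓ' * Dp M ℓ ℓ') - B₀ * Real.log M * Qh M) / Real.log M)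
      atTop (𝓝 0) := by
    have hup := tendsto_const_mul_log_rpow_div_log hθ Ctot
    have hdown : Tendsto (fun M : ℕ => -(Ctot * Real.log M ^ θ / Real.log M)) atTop (𝓝 0) := by
      simpa using hup.neg
    refine tendsto_of_tendsto_of_tendsto_of_le_of_le' hdown hup ?_ ?_
    · filter_upwards [herr, eventually_ge_atTop 2] with M hM hM2
      have hlog : 0 < Real.log M := Real.log_pos (by exact_mod_cast (by omega : 1 < M))
      rw [← neg_div]
      exact div_le_div_of_nonneg_right (neg_le_of_abs_le hM) hlog.le
    · filter_upwards [herr, eventually_ge_atTop 2] with M hM hM2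
      have hlog : 0 < Real.log M := Real.log_pos (by exact_mod_cast (by omega : 1 < M))
      exact div_le_div_of_nonneg_right (le_of_abs_le hM) hlog.le
  have hB : Tendsto (fun M : ℕ => B₀ * (Qh M - QL M)) atTop (𝓝 0) := by
    have := (hQh_lim.sub hQL_lim).const_mul B₀
    simpa using this
  have hsum := hA.add hB
  rw [add_zero] at hsum
  exact hsum.congr' (hsplit.mono fun M hM => hM.symm)

/-- **Anchor `combDiffAsympOfPairData`** (registered sub-goal of line `real_comb_type`; `combDiffAsymp_of_pairData` with explicit
quantifiers): the comb-difference asymptotic of `stub_combDiffAsymp` from pair-level sharp node data. [folklore] -/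
theorem combDiffAsympOfPairData : ∀ c : ℕ → ℝ, (∀ n, 0 ≤ c n) → (∃ C : ℝ, Filter.Tendsto (fun x : ℝ => (∑ n ∈ Finset.Icc 1 ⌊x⌋₊, c n / n) - Real.log x) Filter.atTop (nhds C)) → (∀ p : ℕ, p.Prime → Summable (fun n : ℕ => if p ∣ n then c n / n else 0)) → ∀ α : ℕ → ℝ, ∀ L : ℕ, 1 ≤ L → ∀ B₀ : ℝ, ∀ V : ℕ → ℕ → ℕ → ℕ → ℝ, ∀ Cst θ : ℝ, θ < 1 → (∀ᶠ M : ℕ in Filter.atTop, ∀ ℓ ∈ Finset.Icc 1 L, ∀ ℓ' ∈ Finset.Icc 1 L, ∃ S : ℕ → ℝ, (∀ δ, |S δ| ≤ Cst * Real.log M ^ θ) ∧ (|((∑ n ∈ Finset.Icc 1 (3 * L * M), c n * V M ℓ ℓ' n) - ∑ n ∈ Finset.Icc 1 (3 * L * M), (ArithmeticFunction.vonMangoldt n : ℝ) * V M ℓ ℓ' n) - ∑ n ∈ Finset.Icc 1 (3 * L * M), (c n - ArithmeticFunction.vonMangoldt n) * (B₀ * (Real.sqrt ℓ / Real.sqrt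 ℓ') * (∑ k' ∈ Finset.Icc 1 (⌊(M : ℝ) / (4 * Real.sqrt (Real.log M)) / ((n : ℝ) * ℓ')⌋₊), (if ℓ ∣ n * ℓ' * k' then (1 : ℝ) / k' else 0)) / n + S (Nat.gcd (n * ℓ') ℓ) / n)| ≤ Cst * Real.log M ^ θ)) → Filter.Tendsto (fun M : ℕ => ((∑ ℓ ∈ Finset.Icc 1 L, ∑ ℓ' ∈ Finset.Icc 1 L, α ℓ * α ℓ' * ∑ n ∈ Finset.Icc 1 (3 * L * M), c n * V M ℓ ℓ' n) - (∑ ℓ ∈ Finset.Icc 1 L, ∑ ℓ' ∈ Finset.Icc 1 L, α ℓ * α ℓ' * ∑ n ∈ Finset.Icc 1 (3 * L * M), (ArithmeticFunction.vonMangoldt n : ℝ) * V M ℓ ℓ' n)) / Real.log M - B₀ * ∑ n ∈ Finset.range M, (c n - ArithmeticFunction.vonMangoldt n) / n * (Literature.NumberTheory.LFunctions.GcdForm.gcdForm (fun m => ((α m : ℝ) : ℂ)) L n).re * max (1 - Real.log n / Real.log M) 0) Filter.atTop (nhds 0) :=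
  fun c hc0 hMer hLoc α _ hL B₀ V _ _ hθ hpd => combDiffAsymp_of_pairData c hc0 hMer hLoc α hL B₀ V hθ hpd

end Summit.RiemannHypothesis.RiemannHypothesis.Theorems.SignConeSlackDesign

end
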